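import Summits.KontsevichZagierPeriods.Zeta5Search.LaiSweepShard

/-!
# `κ₃` sweep certificate — shard file 112 of 127 (shards 784–790 of 889)

HONEST FRAMING. Systematic search; no irrationality claim unless certified. This file only checks,
by `decide +kernel`, shards 784–790 of the order-cell sweep of the `κ₃` point `(74, 2180, 444; δ74)`
(engine `LaiSweepEngine`, soundness `LaiSweepJump/Free/Eval/Shard/Kappa3`; a shard is `⟨regime, n,
p, q, p', q', Lo, Up⟩`: `n` cells from `p/q` to `p'/q'` with integer rate sums in `[Lo, Up]`, `K =
128`, `D = 2^40`). It draws NO conclusion: only the capstone `LaiKappa3SweepCert`, which needs all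
127 shard files, does. Kernel cost of this file ≈ 560 cells × 0.3 s.
-/

namespace Summit.KontsevichZagierPeriods.Zeta5Search.Sweep

set_option maxHeartbeats 100000000 in
/-- Shard 784: 80 cells of regime B from `343/395` to `287/330`.
[cite: Lai2024BallRivoal, §4 Lemma 4.3] -/
theorem shard784 :
    Shard.check 128 (2^40)
      ⟨true, 80, 343, 395, 287, 330, 11376451455064, 18732581856792⟩ = true := by
  decide +kernel

set_option maxHeartbeats 100000000 in
/-- Shard 785: 80 cells of regime B from `287/330` to `371/426`.
[cite: Lai2024BallRivoal, §4 Lemma 4.3] -/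
theorem shard785 :
    Shard.check 128 (2^40)
      ⟨true, 80, 287, 330, 371, 426, 10122475541183, 16685227182386⟩ = true := by
  decide +kernel

set_option maxHeartbeats 100000000 in
/-- Shard 786: 80 cells of regime B from `371/426` to `157/180`.
[cite: Lai2024BallRivoal, §4 Lemma 4.3] -/
theorem shard786 :
    Shard.check 128 (2^40)
      ⟨true, 80, 371, 426, 157, 180, 11258488943496, 18577238473835⟩ = true := by
  decide +kernel

set_option maxHeartbeats 100000000 in
/-- Shard 787: 80 cells of regime B from `157/180` to `283/324`.
[cite: Lai2024BallRivoal, §4 Lemma 4.3] -/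
theorem shard787 :
    Shard.check 128 (2^40)
      ⟨true, 80, 157, 180, 283, 324, 10434694474959, 17236203802582⟩ = true := by
  decide +kernel

set_option maxHeartbeats 100000000 in
/-- Shard 788: 80 cells of regime B from `283/324` to `279/319`.
[cite: Lai2024BallRivoal, §4 Lemma 4.3] -/
theorem shard788 :
    Shard.check 128 (2^40)
      ⟨true, 80, 283, 324, 279, 319, 9724031876742, 16078166443401⟩ = true := by
  decide +kernel

set_option maxHeartbeats 100000000 in
/-- Shard 789: 80 cells of regime B from `279/319` to `325/371`.
[cite: Lai2024BallRivoal, §4 Lemma 4.3] -/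
theorem shard789 :
    Shard.check 128 (2^40)
      ⟨true, 80, 279, 319, 325, 371, 11837875608430, 19594483441089⟩ = true := by
  decide +kernel

set_option maxHeartbeats 100000000 in
/-- Shard 790: 80 cells of regime B from `325/371` to `293/334`.
[cite: Lai2024BallRivoal, §4 Lemma 4.3] -/
theorem shard790 :
    Shard.check 128 (2^40)
      ⟨true, 80, 325, 371, 293, 334, 10411113157641, 17251295542001⟩ = true := by
  decide +kernel

/-- The checked shards of this file, in order. [folklore] -/
def shards112 : List (CheckedShard 128 (2^40)) :=
  [⟨_, shard784⟩, ⟨_, shard785⟩, ⟨_, shard786⟩, ⟨_, shard787⟩, ⟨_, shard788⟩,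
    ⟨_, shard789⟩, ⟨_, shard790⟩]

end Summit.KontsevichZagierPeriods.Zeta5Search.Sweep
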